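import Summits.BirchSwinnertonDyer.BirchSwinnertonDyer.Theorems.KolyvaginRoadThreeSchneiderTamAtThreeHeightLogNumeratorExactPCertSplitChecker
import HarnessLib

/-!
# «The height is the logarithm of the numerator» — part 11d: the regime-free split checker in certificate currency
# (`RegMult.CertSplit W p Q 1` with the gcd admissibility test)

HONEST FRAMING (cell `bsd-stepL`, seat `bsd-stepL-tam3-p2` g5; `--supports stmt-BirchSwinnertonDyer-19154 --as helper`): ONE THEOREM,
0 definitions, 0 named facts, 0 sorry; ONE curve per application; nothing class-wide; Schneider's conjecture and BSD asserted nowhere.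
Route-free. The `CertSplit` wrapper of part 11c's value-form checker `heightSplitCoord_ne_zero_of_certSplitRow_padic` (split off only
to respect the 400-line cap), exactly as part 8c wrapped its value form: admissibility from `gcd(Φ_y(Q)·e³, Φ_x(Q)·e⁴) ∣ eⁿ`
(tree `KernelCert.hasNonsingularReductionAt_of_gcd`) and `1 < ‖x(Q)‖_p`; the height clause for every `TateParameterData W p`.
References: [SteinWuthrich2013] §4.2; [SilvermanAEC2009] VII.2.1; [MazurSteinTate2006] §1; tree: parts 8c, 11c.
-/

noncomputable section

open scoped Classical
open scoped ArithmeticFunction.sigma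
open WeierstrassCurve Literature.NumberTheory.EllipticCurves
open Literature.NumberTheory.EllipticCurves.SteinWuthrich2013
open Literature.NumberTheory.EllipticCurves.TateCurve
open Literature.NumberTheory.EllipticCurves.Rank1Residual
open Summit.BirchSwinnertonDyer.Uniform.UI.O2
open Summit.BirchSwinnertonDyer.Rank1Residual Summit.BirchSwinnertonDyer.Rank1Residual.X11b
open Summit.BirchSwinnertonDyer.BirchSwinnertonDyer.Rank1Residual

namespace Summit.BirchSwinnertonDyer.Rank1Residual.X11b.RegMult.HeightLogNumerator

variable {p : ℕ} [hp : Fact p.Prime]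

/-- **THE REGIME-FREE SPLIT ROW CHECKER in certificate currency**: with the gcd admissibility test,
`RegMult.CertSplit W p (x, y) 1` (admissible, and the modified height non-zero for every `TateParameterData W p`).
ONE curve per application. [cite: SteinWuthrich2013, §4.2] [cite: SilvermanAEC2009, VII.2.1] [cite: MazurSteinTate2006, §1] -/
theorem certSplit_of_certSplitRow_padic (hp5 : 5 ≤ p) (W : WeierstrassCurve ℚ) {a₁ a₂ a₃ a₄ a₆ : ℤ}
    (hW : W = ⟨a₁, a₂, a₃, a₄, a₆⟩) [W.IsElliptic] [W.IsGloballyMinimal] (hWm : Mult W p)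
    {a b c4 c6 D A SL L b2 qt u E4c E6c E2c Pic B SB LB Den Ms : ℤ} {e' k n N α w ν M m v N' d : ℕ}
    (Hg : Int.gcd (2 * b + a₁ * a * (p ^ k * e' : ℕ) + a₃ * (p ^ k * e' : ℕ) ^ 3)
        (a₁ * b * (p ^ k * e' : ℕ) - (3 * a ^ 2 + 2 * a₂ * a * (p ^ k * e' : ℕ) ^ 2 + a₄ * (p ^ k * e' : ℕ) ^ 4))
        ∣ (p ^ k * e') ^ n)
    (H₁ : ¬ p ∣ e' ∧ 1 ≤ k ∧ Nat.Coprime a.natAbs (p ^ k * e') ∧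
      c4 = (a₁ ^ 2 + 4 * a₂) ^ 2 - 24 * (2 * a₄ + a₁ * a₃) ∧
      c6 = -(a₁ ^ 2 + 4 * a₂) ^ 3 + 36 * (a₁ ^ 2 + 4 * a₂) * (2 * a₄ + a₁ * a₃) - 216 * (a₃ ^ 2 + 4 * a₆) ∧
      D = -(a₁ ^ 2 + 4 * a₂) ^ 2 * (a₁ ^ 2 * a₆ + 4 * a₂ * a₆ - a₁ * a₃ * a₄ + a₂ * a₃ ^ 2 - a₄ ^ 2) -
        8 * (2 * a₄ + a₁ * a₃) ^ 3 - 27 * (a₃ ^ 2 + 4 * a₆) ^ 2 +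
        9 * (a₁ ^ 2 + 4 * a₂) * (2 * a₄ + a₁ * a₃) * (a₃ ^ 2 + 4 * a₆) ∧
      ¬ (p : ℤ) ∣ c4 ∧
      (p : ℤ) ^ (4 * k) ∣ a ^ (p - 1) - 1 - A ∧ (p : ℤ) ^ α ∣ A ∧ 1 ≤ α ∧ (N + 1) * p ^ (4 * k) ≤ p ^ ((N + 1) * α) ∧
      (p : ℤ) ^ w ∣ L ∧ ¬ (p : ℤ) ^ (w + 1) ∣ L)
    (hSL : (SL : ℚ) = L * ∑ n ∈ Finset.range N, (-1) ^ n * (A : ℚ) ^ (n + 1) / ((n : ℚ) + 1))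
    (H₂ : b2 = a₁ ^ 2 + 4 * a₂ ∧ qt = (p : ℤ) ^ ν * u ∧ ¬ (p : ℤ) ∣ u ∧ 1 ≤ ν ∧
      E4c = 1 + 240 * ∑ n ∈ Finset.range M, (σ 3 (n + 1) : ℤ) * qt ^ (n + 1) ∧
      E6c = 1 - 504 * ∑ n ∈ Finset.range M, (σ 5 (n + 1) : ℤ) * qt ^ (n + 1) ∧
      E2c = 1 - 24 * ∑ n ∈ Finset.range M, (σ 1 (n + 1) : ℤ) * qt ^ (n + 1) ∧
      Pic = ∏ n ∈ Finset.range M, (1 - qt ^ (n + 1)) ^ 24 ∧ ¬ (p : ℤ) ∣ E4c ∧ ¬ (p : ℤ) ∣ E6c ∧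
      (p : ℤ) ^ m ∣ D * E4c ^ 3 - qt * Pic * c4 ^ 3 ∧ m ≤ ν * (M + 2) ∧ 2 * k + 2 * v + ν ≤ m ∧
      2 * k + v ≤ ν * (M + 1))
    (H₃ : (p : ℤ) ^ (2 * k + 2 * v) ∣ u ^ (p - 1) - 1 - B ∧ (p : ℤ) ^ v ∣ B ∧ ¬ (p : ℤ) ^ (v + 1) ∣ B ∧ 1 ≤ v ∧
      v ≤ 2 * k ∧ (N' + 1) * p ^ (2 * k + 2 * v) ≤ p ^ ((N' + 1) * v) ∧
      Den = 720 * (p - 1 : ℕ) * L * c4 * E6c * a ^ 3 * SB ∧ (p : ℤ) ^ d ∣ Den ∧ ¬ (p : ℤ) ^ (d + 1) ∣ Den ∧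
      Ms = 720 * SL * c4 * E6c * a ^ 3 * SB +
        60 * (E4c * c6 * E2c + b2 * c4 * E6c) * ((p ^ k * e' : ℕ) : ℤ) ^ 2 * (p - 1 : ℕ) * L * a ^ 2 * SB +
        c6 * E4c * (720 * a ^ 2 * ((p ^ k * e' : ℕ) : ℤ) ^ 2 - 60 * b2 * a * ((p ^ k * e' : ℕ) : ℤ) ^ 4 +
          (5 * b2 ^ 2 + 3 * c4) * ((p ^ k * e' : ℕ) : ℤ) ^ 6) * (p - 1 : ℕ) ^ 2 * L * LB ∧
      ¬ (p : ℤ) ^ (4 * k + d) ∣ Ms)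
    (hSB : (SB : ℚ) = LB * ∑ n ∈ Finset.range N', (-1) ^ n * (B : ℚ) ^ (n + 1) / ((n : ℚ) + 1))
    {x y : ℚ} (hx : x = a / ((p ^ k * e' : ℕ) : ℚ) ^ 2) (hy : y = b / ((p ^ k * e' : ℕ) : ℚ) ^ 3)
    (h : W.toAffine.Nonsingular x y) :
    RegMult.CertSplit W p (.some x y h) 1 := by
  have hpP : p.Prime := Fact.out
  have he'0 : e' ≠ 0 := by rintro rfl; exact H₁.1 (dvd_zero p)
  have he0 : (p ^ k * e' : ℕ) ≠ 0 := Nat.mul_ne_zero (pow_ne_zero _ hpP.ne_zero) he'0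
  have hpe : p ∣ p ^ k * e' := dvd_mul_of_dvd_left (dvd_pow_self p (by have := H₁.2.1; omega)) _
  have hx1 : 1 < ‖(x : ℚ_[p])‖ :=
    (one_lt_norm_ratCast_iff p x).mpr (KernelCert.padicValRat_x_neg he0 hx H₁.2.2.1 hpe)
  have hadm : W.IsAdmissible p (.some x y h) :=
    isAdmissible_of_one_lt_norm (by omega) h hx1
      (KernelCert.hasNonsingularReductionAt_of_gcd W hW he0 hx hy H₁.2.2.1 Hg)
  refine ⟨by rw [one_nsmul]; exact hadm, fun Dq => ?_⟩
  rw [one_nsmul]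
  show heightSplitCoord W p Dq.q x y ≠ 0
  exact heightSplitCoord_ne_zero_of_certSplitRow_padic hp5 W hW hWm H₁ hSL H₂ H₃ hSB hx h.left
    Dq.norm_q_lt_one Dq.tateJ_eq


end Summit.BirchSwinnertonDyer.Rank1Residual.X11b.RegMult.HeightLogNumerator

end
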